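import Summits.QuantumFields.BalabanUV.Beta.D1BFx.PackedColumnJetMass
import Summits.QuantumFields.BalabanUV.Beta.D1BFx.RestTableBlockMass

/-!
# `BalabanUV.Beta.D1BFx.PackedColumnTableMass` — road «BF-x» for binder row D1, slot (K), DICT-CHAIN-SPEC §2 (II): **«G0-TABLE-MASS» — THE PLAIN MASSES OF
# THE ROAD's M-SIDE TABLES CARRYING TWO GAUGED WEIGHTS `colH G₀ n`: the diagonal (tadpole-type) tables `Σ_κ wsum (colH G₀ n μ y κ) (u ↦ colH G₀ n ν y′ κ u • T κ u)`
# (PART 7∕8's `𝒳₂`, the gauged ghost `𝒟`) — `≤ 4·W²·e^{−(κ′∕8)|y′−y|₁}·Zl 4 (κ′∕(8n))·mT`, POWER `n⁻⁴ × mT` — and the second-order tables `vertex2OfK G₀ n S₂ μ y ν y′`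
# (the literal's `W2litInf`, (J1)'s left member) — `≤ 16·C_{G₀}²·(1 + 16∕κ′)⁴·Zl 4 (δ∕2)·(n⁴)⁻¹·mT j i·e^{−min (κ′∕8) (δ∕2)·|y′−y|₁}`, POWER `n⁻⁴`** (companion of
# «G0-JET-MASS» `PackedColumnJetMass`, split off by the 400-line rule; `G₀ := coDressKBmAt (toSite r) n (KInvStep 3 n 0)`; UNCONDITIONAL)

HONEST DEPENDENCY (cell records, verbatim): «continuum YM on T⁴ ⇐ BetaPertH ∧ nine spine estimates (0/9 proved); BetaPertH ⇐ (D1) ∧ (D4) ∧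
CAP+tail; G-an2-4 gates asym, D1 and NE2/3/4.»  HONEST FRAMING (cell contract, verbatim): «discharging `BetaPertH` makes Bałaban's UV stability
UNCONDITIONAL — a real constructive-QFT result; it is NOT the continuum limit and NOT the Clay problem.»  THIS MODULE DISCHARGES NOTHING of the
wall: [folklore] `ℓ¹` bookkeeping BY NAME over «G0-COL-ENV» ∕ «G0-JET-MASS» (this lineage: `abs_colH_G₀_road_le`, `tsum_abs_colH_G₀_mul_colH_G₀_le`) and d1-leaf-04's
generic lemmas (`RestJetBlockMass.mass_sum_wsum_le`, `RestTableBlockMass.mass_blk_vertex2OfK_le ∕ min_rate_coarse ∕ l1_smul_sub`, `GhostWordJetLetters.Zl_kappa_le`).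
Every mass letter of the superposed family ∕ pair pack is a DISPLAYED hypothesis on an ARBITRARY family; nothing about Bałaban's tables is asserted.  No
definition, no `def … : Prop`, nothing cited, 0 sorry.  NO (1.22) unit row is proved here.  0 root-level binders of row D1 discharged (hW ∕ hR-sockets ∕
hSX-socket ∕ D1Tel ∕ D1Rep = 0); (K) NOT closed; NOT D1, NOT `BetaPertH`, NOT continuum, NOT Clay.

ABSOLUTE RULE (cell charter, verbatim): «No internally-minted statement may enter as a cited fact. Every hypothesis is either kernel-proved in
this package or a verbatim quotation of a PUBLISHED theorem with page reference. The manuscript(s) under audit are NOT citable for their own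
disputed steps — they are the thing under adjudication; programme-internal (2001/route/tribunal) claims are never citable.»

CONTENT (`n = m + 1`, `κ′ = kappa163 4 ∕ 4`, `C_{G₀} = (MG163 4·periodConst (kappa163 4) 3)·(1 + 8(1 + e^{κ′}))·e^{κ′}`, `W = (n⁴)⁻¹·C_{G₀}`, in-block root `r ∈ box 4 n`).
* §1 [folklore, ANY fibre `F`] **`mass_sum_wsum_mul_colH_G₀_le`** — THE DIAGONAL (TADPOLE-TYPE) TABLE: for a family `T κ u : MKer 4 F` with plain `u`-masses `≤ mT`,
  `fun x z a b => Σ_κ wsum (colH G₀ n μ y κ) (u ↦ fun x z a b => colH G₀ n ν y′ κ u * T κ u x z a b) x z a b` has summable plain mass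
  `≤ 4·W²·e^{−(κ′∕8)|y′ − y|₁}·Zl 4 (κ′∕(8n))·mT` (the product weight absorbs the inner multiplication; `tsum_abs_colH_G₀_mul_colH_G₀_le` + `mass_sum_wsum_le` at `W ≡ 1`)
  — the `hWm`-type letter (`Σ mass (𝒲 μ 0 ν z) ≤ mW·e^{−κ|z|₁}`) of the comb-FP table `𝒳₂` (`T := nFcol r n`) and of the gauged ghost tadpole table `𝒟` (`T := gh₂`, times the scalar `n²`).
* §2 [folklore] **`mass_blk_vertex2OfK_G₀_le`** — THE SECOND-ORDER TABLES: d1-leaf-04's generic `mass_blk_vertex2OfK_le` (ANY packed `K` with a column envelope)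
  AT «G0-COL-ENV» (`C_H = W`, `a = κ′∕(4n)`): for a pair pack `S₂` with plain block letters `mT j i·e^{−δ|u′ − u|₁}` (`0 < δ`), every block of
  `vertex2OfK G₀ n S₂ μ y ν y′` has summable plain mass `≤ 16·C_{G₀}²·(1 + 16∕κ′)⁴·Zl 4 (δ∕2)·(n⁴)⁻¹·mT j i·e^{−min (κ′∕8) (δ∕2)·|y′ − y|₁}` — POWER `n⁻⁴`
  (the undressed N-side tables have `n⁻⁶`, `mass_blk_vertex2OfK_NlegRoad_le`); leaf-03 g24 W-2: the literal's `W2litInf m r S₂ μ y ν y′` IS `vertex2OfK G₀ (m+1) S₂ μ y ν y′` (`rfl`).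
NOT HERE (honest): the co-frame half `cofPairInf` of leaf-03's `W2NInf` («COFRAME-MASS», their lane); the packs' own letters; any (1.22) row.
Unit `b2b-balaban-gan24-formalise-leaf-05` (gen 53), G-an2-4 swarm leaf prover 05, road «BF-x» supplier; INTENT «G0-JET-MASS» ∕ A-lines (journal).
-/

noncomputable section

open Finset
open scoped BigOperators
open Literature.MathematicalPhysics.QuantumFieldTheory.Balaban1983to89
open Literature.MathematicalPhysics.QuantumFieldTheory.Balaban1983to89.Beta
open B12Sec2to5 (l1 l1_nonneg)
open B5Hk163Strip (kappa163 kappa163_pos)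
open B5Hk163Decay (MG163)
open B4TorusKernel (periodConst)
open ExpKernelCalculus (Site MKer Zl Zl_pos Zl_nonneg tsum_exp_shift' summable_exp_shift')
open AffineAveraging (box toSite)
open OneStepResolventKernel (Fib wsum)
open OneStepKernelFamily (colH KInvStep vertexOfK)
open SecondOrderResponse (vertex2OfK)
open Summit.QuantumFields.BalabanUV.Beta.AxialDressingRooted (coDressKBmAt)
open Summit.QuantumFields.BalabanUV.Beta.D1BFx.PackedKernelSplit (blk)
open Summit.QuantumFields.BalabanUV.Beta.D1BFx.GhostWordJetLetters (Zl_kappa_le)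
open Summit.QuantumFields.BalabanUV.Beta.D1BFx.RestJetBlockMass (mass_sum_wsum_le)
open Summit.QuantumFields.BalabanUV.Beta.D1BFx.RestTableBlockMass (mass_blk_vertex2OfK_le min_rate_coarse l1_smul_sub)
open Summit.QuantumFields.BalabanUV.Beta.D1BFx.PackedColumnEnvelope (abs_colH_G₀_road_le colH_G₀_road_weight_nonneg)
open Summit.QuantumFields.BalabanUV.Beta.D1BFx.PackedColumnJetMass (tsum_abs_colH_G₀_mul_colH_G₀_le)

namespace Summit.QuantumFields.BalabanUV.Beta.D1BFx.PackedColumnTableMass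

variable (m : ℕ) {r : Fin (3 + 1) → ℕ} (hr : r ∈ box (3 + 1) (m + 1))
include hr

/-! ## §1 The diagonal (tadpole-type) table with two gauged weights -/

/-- [folklore] **«G0-TADPOLE-TABLE-MASS»: THE PLAIN MASS OF A DIAGONAL (TADPOLE-TYPE) TABLE WITH TWO GAUGED WEIGHTS** (ANY fibre `F`): for a family
`T κ u : MKer 4 F` with plain `u`-masses `Σ'_{(p,q)} Σ_{ab} |T κ u p q a b| ≤ mT`, the table
`fun x z a b => Σ_κ wsum (colH G₀ n μ y κ) (u ↦ fun x z a b => colH G₀ n ν y′ κ u * T κ u x z a b) x z a b` — the shape of PART 7∕8's `𝒳₂` (`T := nFcol r n`) and of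
the gauged ghost tadpole table `𝒟` (`T := gh₂`, up to the scalar `n²`) — has summable plain mass `≤ 4·W²·e^{−(κ′∕8)|y′ − y|₁}·Zl 4 (κ′∕(8n))·mT`,
`W = (n⁴)⁻¹·C_{G₀}` — POWER `n⁻⁴ × mT`, exponential in the coarse separation (§1b + d1-leaf-04's `mass_sum_wsum_le` at the weight `W ≡ 1`). -/
theorem mass_sum_wsum_mul_colH_G₀_le {F : Type*} [Fintype F] {T : Fin (3 + 1) → (Fin (3 + 1) → ℤ) → MKer 4 F} {mT : ℝ}
    (hTs : ∀ κ u, Summable fun p : Site 4 × Site 4 => ∑ a, ∑ b, |T κ u p.1 p.2 a b|)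
    (hTm : ∀ κ u, ∑' p : Site 4 × Site 4, ∑ a, ∑ b, |T κ u p.1 p.2 a b| ≤ mT)
    (μ : Fin (3 + 1)) (y : Fin (3 + 1) → ℤ) (ν : Fin (3 + 1)) (y' : Fin (3 + 1) → ℤ) :
    (Summable fun p : Site 4 × Site 4 => ∑ a, ∑ b,
        |(∑ κ : Fin (3 + 1), wsum (colH (coDressKBmAt (toSite r) (m + 1) (KInvStep (d := 3) (m + 1) 0)) (m + 1) μ y κ)
            (fun u => fun x z a b => colH (coDressKBmAt (toSite r) (m + 1) (KInvStep (d := 3) (m + 1) 0)) (m + 1) ν y' κ u * T κ u x z a b))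
          p.1 p.2 a b|) ∧
      ∑' p : Site 4 × Site 4, ∑ a, ∑ b,
        |(∑ κ : Fin (3 + 1), wsum (colH (coDressKBmAt (toSite r) (m + 1) (KInvStep (d := 3) (m + 1) 0)) (m + 1) μ y κ)
            (fun u => fun x z a b => colH (coDressKBmAt (toSite r) (m + 1) (KInvStep (d := 3) (m + 1) 0)) (m + 1) ν y' κ u * T κ u x z a b))
          p.1 p.2 a b|
        ≤ 4 * (((((m + 1 : ℕ) : ℝ) ^ 4)⁻¹ * ((MG163 4 * periodConst (kappa163 4) 3)
              * (1 + 8 * (1 + Real.exp (kappa163 4 / 4))) * Real.exp (kappa163 4 / 4)))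
          * ((((m + 1 : ℕ) : ℝ) ^ 4)⁻¹ * ((MG163 4 * periodConst (kappa163 4) 3)
              * (1 + 8 * (1 + Real.exp (kappa163 4 / 4))) * Real.exp (kappa163 4 / 4)))
          * Real.exp (-(kappa163 4 / 4 / 8) * l1 (y' - y)) * Zl 4 (kappa163 4 / 4 / (8 * ((m + 1 : ℕ) : ℝ)))) * mT := by
  set w₁ : Fin (3 + 1) → (Fin (3 + 1) → ℤ) → ℝ := fun κ u =>
    colH (coDressKBmAt (toSite r) (m + 1) (KInvStep (d := 3) (m + 1) 0)) (m + 1) μ y κ u with hw₁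
  set w₂ : Fin (3 + 1) → (Fin (3 + 1) → ℤ) → ℝ := fun κ u =>
    colH (coDressKBmAt (toSite r) (m + 1) (KInvStep (d := 3) (m + 1) 0)) (m + 1) ν y' κ u with hw₂
  set B : ℝ := ((((m + 1 : ℕ) : ℝ) ^ 4)⁻¹ * ((MG163 4 * periodConst (kappa163 4) 3)
              * (1 + 8 * (1 + Real.exp (kappa163 4 / 4))) * Real.exp (kappa163 4 / 4)))
          * ((((m + 1 : ℕ) : ℝ) ^ 4)⁻¹ * ((MG163 4 * periodConst (kappa163 4) 3)
              * (1 + 8 * (1 + Real.exp (kappa163 4 / 4))) * Real.exp (kappa163 4 / 4)))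
          * Real.exp (-(kappa163 4 / 4 / 8) * l1 (y' - y)) * Zl 4 (kappa163 4 / 4 / (8 * ((m + 1 : ℕ) : ℝ))) with hB
  -- the product weight absorbs the inner multiplication: `wsum (w₁ κ) (u ↦ w₂ κ u • T κ u) = wsum (w₁ κ * w₂ κ) (T κ)`
  have e : (∑ κ : Fin (3 + 1), wsum (w₁ κ) (fun u => fun x z a b => w₂ κ u * T κ u x z a b))
      = ∑ κ : Fin (3 + 1), wsum (fun u => w₁ κ u * w₂ κ u) (T κ) := by
    refine Finset.sum_congr rfl fun κ _ => ?_
    funext x z a b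
    simp only [OneStepResolventKernel.wsum]
    exact tsum_congr fun u => by ring
  have hmT : 0 ≤ mT := (tsum_nonneg fun p => Finset.sum_nonneg fun a _ => Finset.sum_nonneg fun b _ => abs_nonneg _).trans (hTm 0 0)
  have hWpos : ∀ p : Site 4 × Site 4, (0 : ℝ) < (fun _ => (1 : ℝ)) p := fun _ => one_pos
  have hKs : ∀ κ u, Summable fun p : Site 4 × Site 4 => ∑ a, ∑ b, |T κ u p.1 p.2 a b| * (fun _ : Site 4 × Site 4 => (1 : ℝ)) p :=
    fun κ u => (hTs κ u).congr fun p => by simp only [mul_one]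
  have hKm : ∀ κ u, ∑' p : Site 4 × Site 4, ∑ a, ∑ b, |T κ u p.1 p.2 a b| * (fun _ : Site 4 × Site 4 => (1 : ℝ)) p ≤ mT :=
    fun κ u => by simp only [mul_one]; exact hTm κ u
  have hw : ∀ κ : Fin (3 + 1), (Summable fun u => |w₁ κ u * w₂ κ u| * mT) ∧ ∑' u, |w₁ κ u * w₂ κ u| * mT ≤ mT * B := by
    intro κ
    obtain ⟨hs, hb⟩ := tsum_abs_colH_G₀_mul_colH_G₀_le m hr κ μ ν y y'
    have e2 : (fun u : Fin (3 + 1) → ℤ => |w₁ κ u * w₂ κ u| * mT) = fun u => mT * (|w₁ κ u| * |w₂ κ u|) := funext fun u => by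
      rw [abs_mul]; ring
    rw [e2]
    refine ⟨hs.mul_left mT, ?_⟩
    rw [tsum_mul_left]
    exact mul_le_mul_of_nonneg_left hb hmT
  have h := mass_sum_wsum_le (Finset.univ : Finset (Fin (3 + 1))) (w := fun κ u => w₁ κ u * w₂ κ u) (K := fun κ u => T κ u)
    (W := fun _ => (1 : ℝ)) (ρ := fun _ _ => mT) (M := fun _ => mT * B) hWpos hKs hKm (fun κ => (hw κ).1) (fun κ => (hw κ).2)
  rw [← e] at h
  simp only [mul_one] at h
  refine ⟨h.1, h.2.trans (le_of_eq ?_)⟩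
  rw [Finset.sum_const, Finset.card_univ, Fintype.card_fin, nsmul_eq_mul]
  push_cast
  ring

/-! ## §2 The block masses of the road's M-side packed second-order tables `vertex2OfK G₀ n S₂` -/

/-- [folklore] **«G0-TABLE-MASS»: THE BLOCK MASSES OF THE ROAD's M-SIDE PACKED SECOND-ORDER TABLES** (UNCONDITIONAL; d1-leaf-04's `mass_blk_vertex2OfK_le` at the
column envelope «G0-COL-ENV» `C_H = (n⁴)⁻¹·C_{G₀}`, `a = κ′∕(4n)`): for any PACKED pair pack `S₂` with plain block letters `mT j i·e^{−δ|u′−u|₁}` (`0 < δ`), every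
block of `vertex2OfK G₀ n S₂ μ y ν y′` has summable plain mass
`≤ 16·C_{G₀}²·(1 + 16∕κ′)⁴·Zl 4 (δ∕2)·(n⁴)⁻¹·mT j i·e^{−min (κ′∕8) (δ∕2)·|y′ − y|₁}` — POWER `n⁻⁴` (N side: `n⁻⁶`). -/
theorem mass_blk_vertex2OfK_G₀_le {S₂ : Fin 4 → Site 4 → Fin 4 → Site 4 → MKer 4 (Fib 3)} {δ : ℝ} {mT : Bool → Bool → ℝ} (hδ : 0 < δ)
    (hTs : ∀ κ u κ' u' j i, Summable fun p : Site 4 × Site 4 => ∑ g, ∑ f, |blk (S₂ κ u κ' u') j i p.1 p.2 g f|)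
    (hTm : ∀ κ u κ' u' j i, ∑' p : Site 4 × Site 4, ∑ g, ∑ f, |blk (S₂ κ u κ' u') j i p.1 p.2 g f| ≤ mT j i * Real.exp (-δ * l1 (u' - u)))
    (μ : Fin 4) (y : Site 4) (ν : Fin 4) (y' : Site 4) (j i : Bool) :
    (Summable fun p : Site 4 × Site 4 => ∑ g, ∑ f,
        |blk (vertex2OfK (coDressKBmAt (toSite r) (m + 1) (KInvStep (d := 3) (m + 1) 0)) (m + 1) S₂ μ y ν y') j i p.1 p.2 g f|) ∧
      ∑' p : Site 4 × Site 4, ∑ g, ∑ f,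
          |blk (vertex2OfK (coDressKBmAt (toSite r) (m + 1) (KInvStep (d := 3) (m + 1) 0)) (m + 1) S₂ μ y ν y') j i p.1 p.2 g f|
        ≤ 16 * ((MG163 4 * periodConst (kappa163 4) 3) * (1 + 8 * (1 + Real.exp (kappa163 4 / 4))) * Real.exp (kappa163 4 / 4)) ^ 2
            * (1 + 16 / (kappa163 4 / 4)) ^ 4 * Zl 4 (δ / 2)
          * ((((m + 1 : ℕ) : ℝ)) ^ 4)⁻¹ * mT j i * Real.exp (-(min (kappa163 4 / 4 / 8) (δ / 2)) * l1 (y' - y)) := by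
  have hn0 : (0 : ℝ) < ((m + 1 : ℕ) : ℝ) := by exact_mod_cast Nat.succ_pos m
  have hκ : 0 < kappa163 4 := kappa163_pos 4
  set K₀ : ℝ := (MG163 4 * periodConst (kappa163 4) 3) * (1 + 8 * (1 + Real.exp (kappa163 4 / 4))) * Real.exp (kappa163 4 / 4) with hK₀
  set CH : ℝ := (((m + 1 : ℕ) : ℝ) ^ 4)⁻¹ * K₀ with hCH
  set aa : ℝ := kappa163 4 / 4 / (4 * ((m + 1 : ℕ) : ℝ)) with haa
  have haa0 : 0 < aa := by positivity
  -- the column envelope of the road's M-side pack («G0-COL-ENV»)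
  have hcol : ∀ ρ y₀ κ u, |colH (coDressKBmAt (toSite r) (m + 1) (KInvStep (d := 3) (m + 1) 0)) (m + 1) ρ y₀ κ u|
      ≤ CH * Real.exp (-aa * l1 (u - ((m + 1 : ℕ) : ℤ) • y₀)) := fun ρ y₀ κ u => by
    have h := abs_colH_G₀_road_le m hr ρ y₀ κ u
    rw [hCH, haa]
    exact h
  have hCH0 : 0 ≤ CH := colH_G₀_road_weight_nonneg m
  have hmT : 0 ≤ mT j i := by
    have h := (tsum_nonneg fun p => Finset.sum_nonneg fun g _ => Finset.sum_nonneg fun f _ => abs_nonneg _).trans (hTm 0 0 0 0 j i)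
    have e0 : l1 ((0 : Site 4) - 0) = 0 := by simp [l1]
    rw [e0, mul_zero, Real.exp_zero, mul_one] at h
    exact h
  obtain ⟨hs, hb⟩ := mass_blk_vertex2OfK_le (coDressKBmAt (toSite r) (m + 1) (KInvStep (d := 3) (m + 1) 0)) (m + 1) haa0 hδ hCH0 hcol
    hTs hTm μ y ν y' j i
  refine ⟨hs, hb.trans ?_⟩
  -- the exponential: `min (aa∕2) (δ∕2)·|n•y′ − n•y|₁ ≥ min (κ′∕8) (δ∕2)·|y′ − y|₁`
  have hexp : Real.exp (-(min (aa / 2) (δ / 2)) * l1 (((m + 1 : ℕ) : ℤ) • y' - ((m + 1 : ℕ) : ℤ) • y))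
      ≤ Real.exp (-(min (kappa163 4 / 4 / 8) (δ / 2)) * l1 (y' - y)) := by
    apply Real.exp_le_exp.2
    have hL := l1_nonneg (y' - y)
    have e1 : aa / 2 = (kappa163 4 / 4 / 8) / ((m + 1 : ℕ) : ℝ) := by
      rw [haa]; field_simp; ring
    have h := min_rate_coarse m (p := kappa163 4 / 4 / 8) (q := δ / 2) (L := l1 (y' - y)) (by positivity) hL
    rw [← e1] at h
    rw [l1_smul_sub]
    linarith
  -- the constants: `CH²·Zl 4 (aa∕2) = n⁻⁸·K₀²·Zl ≤ n⁻⁴·K₀²·(1 + 16∕κ′)⁴`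
  have hZl : (((m + 1 : ℕ) : ℝ) ^ 4)⁻¹ * Zl 4 (aa / 2) ≤ (1 + 16 / (kappa163 4 / 4)) ^ 4 := by
    have h := Zl_kappa_le m
    have e4 : kappa163 (3 + 1) / (3 + 1) = kappa163 4 / 4 := by norm_num
    rw [e4] at h
    have e2 : aa / 2 = kappa163 4 / 4 / (8 * ((m + 1 : ℕ) : ℝ)) := by rw [haa]; field_simp; ring
    rw [e2]
    exact h
  have hZ0 : 0 ≤ Zl 4 (δ / 2) := Zl_nonneg (by positivity)
  have hZa0 : 0 ≤ Zl 4 (aa / 2) := Zl_nonneg (by positivity)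
  have hK₀0 : 0 ≤ K₀ := by
    have hn4 : 0 < ((((m + 1 : ℕ) : ℝ)) ^ 4)⁻¹ := by positivity
    exact (mul_nonneg_iff_of_pos_left hn4).1 hCH0
  set B : ℝ := (1 + 16 / (kappa163 4 / 4)) ^ 4 with hB
  have eCH : 16 * CH * CH * mT j i * (Zl 4 (aa / 2) * Zl 4 (δ / 2))
      = 16 * K₀ ^ 2 * ((((m + 1 : ℕ) : ℝ) ^ 4)⁻¹ * Zl 4 (aa / 2)) * Zl 4 (δ / 2) * ((((m + 1 : ℕ) : ℝ)) ^ 4)⁻¹ * mT j i := by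
    rw [hCH]; ring
  have hrest : 0 ≤ Zl 4 (δ / 2) * ((((m + 1 : ℕ) : ℝ)) ^ 4)⁻¹ * mT j i := by positivity
  calc 16 * CH * CH * mT j i * (Zl 4 (aa / 2) * Zl 4 (δ / 2))
        * Real.exp (-(min (aa / 2) (δ / 2)) * l1 (((m + 1 : ℕ) : ℤ) • y' - ((m + 1 : ℕ) : ℤ) • y))
      ≤ 16 * CH * CH * mT j i * (Zl 4 (aa / 2) * Zl 4 (δ / 2)) * Real.exp (-(min (kappa163 4 / 4 / 8) (δ / 2)) * l1 (y' - y)) :=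
        mul_le_mul_of_nonneg_left hexp (by positivity)
    _ = (16 * K₀ ^ 2 * ((((m + 1 : ℕ) : ℝ) ^ 4)⁻¹ * Zl 4 (aa / 2)))
        * (Zl 4 (δ / 2) * ((((m + 1 : ℕ) : ℝ)) ^ 4)⁻¹ * mT j i) * Real.exp (-(min (kappa163 4 / 4 / 8) (δ / 2)) * l1 (y' - y)) := by
        rw [eCH]; ring
    _ ≤ (16 * K₀ ^ 2 * B) * (Zl 4 (δ / 2) * ((((m + 1 : ℕ) : ℝ)) ^ 4)⁻¹ * mT j i) * Real.exp (-(min (kappa163 4 / 4 / 8) (δ / 2)) * l1 (y' - y)) := by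
        have h1 : 16 * K₀ ^ 2 * ((((m + 1 : ℕ) : ℝ) ^ 4)⁻¹ * Zl 4 (aa / 2)) ≤ 16 * K₀ ^ 2 * B :=
          mul_le_mul_of_nonneg_left hZl (by positivity)
        exact mul_le_mul_of_nonneg_right (mul_le_mul_of_nonneg_right h1 hrest) (Real.exp_pos _).le
    _ = 16 * K₀ ^ 2 * B * Zl 4 (δ / 2) * ((((m + 1 : ℕ) : ℝ)) ^ 4)⁻¹ * mT j i * Real.exp (-(min (kappa163 4 / 4 / 8) (δ / 2)) * l1 (y' - y)) := by
        ring

/-! ## §2′ The same block masses at the BLOCK-SCALE rate (v1.1; d1-leaf-01 g24 R2, journal l.43232) -/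

omit hr in
/-- [folklore] `min (p∕n) q · (n·L) = min p (n·q) · L` for `n = m + 1` — the coarse-variable rate WITHOUT weakening `n·q` to `q`. -/
theorem min_rate_coarse_eq (p q L : ℝ) :
    min (p / ((m + 1 : ℕ) : ℝ)) q * (((m + 1 : ℕ) : ℝ) * L) = min p (((m + 1 : ℕ) : ℝ) * q) * L := by
  have hn0 : (0 : ℝ) < ((m + 1 : ℕ) : ℝ) := by exact_mod_cast Nat.succ_pos m
  rw [← mul_assoc, min_mul_of_nonneg _ _ hn0.le, div_mul_cancel₀ _ hn0.ne', mul_comm q]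

/-- [folklore] **«G0-TABLE-MASS» AT THE BLOCK-SCALE RATE** (v1.1, §2′ = §2 minus the `min_rate_coarse` weakening; asked by d1-leaf-01 g24, R2 journal l.43232):
the same summable plain block masses of `vertex2OfK G₀ n S₂ μ y ν y′` (`n = m + 1`), with the decay
`e^{−min (κ′∕8) (n·δ∕2)·|y′ − y|₁}` — the pair letter's rate `δ` is read in the COARSE variable WITH its block factor `n` (`|n•y′ − n•y|₁ = n·|y′ − y|₁`,
`min (κ′∕(8n)) (δ∕2)·n = min (κ′∕8) (n·δ∕2)`), so that a block-scale pair rate `δ = δ₀∕n` yields the n-FREE table rate `min (κ′∕8) (δ₀∕2)`; the constant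
is byte-for-byte §2's (`16·C_{G₀}²·(1 + 16∕κ′)⁴·Zl 4 (δ∕2)·(n⁴)⁻¹·mT j i`; at `δ = δ₀∕n` it reads `n⁰ × mT` by `Zl 4 (δ₀∕(2n)) ≍ n⁴`). UNCONDITIONAL. -/
theorem mass_blk_vertex2OfK_G₀_le' {S₂ : Fin 4 → Site 4 → Fin 4 → Site 4 → MKer 4 (Fib 3)} {δ : ℝ} {mT : Bool → Bool → ℝ} (hδ : 0 < δ)
    (hTs : ∀ κ u κ' u' j i, Summable fun p : Site 4 × Site 4 => ∑ g, ∑ f, |blk (S₂ κ u κ' u') j i p.1 p.2 g f|)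
    (hTm : ∀ κ u κ' u' j i, ∑' p : Site 4 × Site 4, ∑ g, ∑ f, |blk (S₂ κ u κ' u') j i p.1 p.2 g f| ≤ mT j i * Real.exp (-δ * l1 (u' - u)))
    (μ : Fin 4) (y : Site 4) (ν : Fin 4) (y' : Site 4) (j i : Bool) :
    (Summable fun p : Site 4 × Site 4 => ∑ g, ∑ f,
        |blk (vertex2OfK (coDressKBmAt (toSite r) (m + 1) (KInvStep (d := 3) (m + 1) 0)) (m + 1) S₂ μ y ν y') j i p.1 p.2 g f|) ∧
      ∑' p : Site 4 × Site 4, ∑ g, ∑ f,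
          |blk (vertex2OfK (coDressKBmAt (toSite r) (m + 1) (KInvStep (d := 3) (m + 1) 0)) (m + 1) S₂ μ y ν y') j i p.1 p.2 g f|
        ≤ 16 * ((MG163 4 * periodConst (kappa163 4) 3) * (1 + 8 * (1 + Real.exp (kappa163 4 / 4))) * Real.exp (kappa163 4 / 4)) ^ 2
            * (1 + 16 / (kappa163 4 / 4)) ^ 4 * Zl 4 (δ / 2)
          * ((((m + 1 : ℕ) : ℝ)) ^ 4)⁻¹ * mT j i
          * Real.exp (-(min (kappa163 4 / 4 / 8) (((m + 1 : ℕ) : ℝ) * (δ / 2))) * l1 (y' - y)) := by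
  have hn0 : (0 : ℝ) < ((m + 1 : ℕ) : ℝ) := by exact_mod_cast Nat.succ_pos m
  have hκ : 0 < kappa163 4 := kappa163_pos 4
  set K₀ : ℝ := (MG163 4 * periodConst (kappa163 4) 3) * (1 + 8 * (1 + Real.exp (kappa163 4 / 4))) * Real.exp (kappa163 4 / 4) with hK₀
  set CH : ℝ := (((m + 1 : ℕ) : ℝ) ^ 4)⁻¹ * K₀ with hCH
  set aa : ℝ := kappa163 4 / 4 / (4 * ((m + 1 : ℕ) : ℝ)) with haa
  have haa0 : 0 < aa := by positivity
  -- the column envelope of the road's M-side pack («G0-COL-ENV»)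
  have hcol : ∀ ρ y₀ κ u, |colH (coDressKBmAt (toSite r) (m + 1) (KInvStep (d := 3) (m + 1) 0)) (m + 1) ρ y₀ κ u|
      ≤ CH * Real.exp (-aa * l1 (u - ((m + 1 : ℕ) : ℤ) • y₀)) := fun ρ y₀ κ u => by
    have h := abs_colH_G₀_road_le m hr ρ y₀ κ u
    rw [hCH, haa]
    exact h
  have hCH0 : 0 ≤ CH := colH_G₀_road_weight_nonneg m
  have hmT : 0 ≤ mT j i := by
    have h := (tsum_nonneg fun p => Finset.sum_nonneg fun g _ => Finset.sum_nonneg fun f _ => abs_nonneg _).trans (hTm 0 0 0 0 j i)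
    have e0 : l1 ((0 : Site 4) - 0) = 0 := by simp [l1]
    rw [e0, mul_zero, Real.exp_zero, mul_one] at h
    exact h
  obtain ⟨hs, hb⟩ := mass_blk_vertex2OfK_le (coDressKBmAt (toSite r) (m + 1) (KInvStep (d := 3) (m + 1) 0)) (m + 1) haa0 hδ hCH0 hcol
    hTs hTm μ y ν y' j i
  refine ⟨hs, hb.trans ?_⟩
  -- the exponential, WITHOUT weakening: `min (aa∕2) (δ∕2)·|n•y′ − n•y|₁ = min (κ′∕8) (n·δ∕2)·|y′ − y|₁`
  have hexp : Real.exp (-(min (aa / 2) (δ / 2)) * l1 (((m + 1 : ℕ) : ℤ) • y' - ((m + 1 : ℕ) : ℤ) • y))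
      ≤ Real.exp (-(min (kappa163 4 / 4 / 8) (((m + 1 : ℕ) : ℝ) * (δ / 2))) * l1 (y' - y)) := by
    apply le_of_eq
    have e1 : aa / 2 = (kappa163 4 / 4 / 8) / ((m + 1 : ℕ) : ℝ) := by
      rw [haa]; field_simp; ring
    rw [l1_smul_sub, e1, neg_mul, neg_mul, min_rate_coarse_eq m]
  -- the constants: `CH²·Zl 4 (aa∕2) = n⁻⁸·K₀²·Zl ≤ n⁻⁴·K₀²·(1 + 16∕κ′)⁴`
  have hZl : (((m + 1 : ℕ) : ℝ) ^ 4)⁻¹ * Zl 4 (aa / 2) ≤ (1 + 16 / (kappa163 4 / 4)) ^ 4 := by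
    have h := Zl_kappa_le m
    have e4 : kappa163 (3 + 1) / (3 + 1) = kappa163 4 / 4 := by norm_num
    rw [e4] at h
    have e2 : aa / 2 = kappa163 4 / 4 / (8 * ((m + 1 : ℕ) : ℝ)) := by rw [haa]; field_simp; ring
    rw [e2]
    exact h
  have hZ0 : 0 ≤ Zl 4 (δ / 2) := Zl_nonneg (by positivity)
  have hZa0 : 0 ≤ Zl 4 (aa / 2) := Zl_nonneg (by positivity)
  have hK₀0 : 0 ≤ K₀ := by
    have hn4 : 0 < ((((m + 1 : ℕ) : ℝ)) ^ 4)⁻¹ := by positivity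
    exact (mul_nonneg_iff_of_pos_left hn4).1 hCH0
  set B : ℝ := (1 + 16 / (kappa163 4 / 4)) ^ 4 with hB
  have eCH : 16 * CH * CH * mT j i * (Zl 4 (aa / 2) * Zl 4 (δ / 2))
      = 16 * K₀ ^ 2 * ((((m + 1 : ℕ) : ℝ) ^ 4)⁻¹ * Zl 4 (aa / 2)) * Zl 4 (δ / 2) * ((((m + 1 : ℕ) : ℝ)) ^ 4)⁻¹ * mT j i := by
    rw [hCH]; ring
  have hrest : 0 ≤ Zl 4 (δ / 2) * ((((m + 1 : ℕ) : ℝ)) ^ 4)⁻¹ * mT j i := by positivity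
  calc 16 * CH * CH * mT j i * (Zl 4 (aa / 2) * Zl 4 (δ / 2))
        * Real.exp (-(min (aa / 2) (δ / 2)) * l1 (((m + 1 : ℕ) : ℤ) • y' - ((m + 1 : ℕ) : ℤ) • y))
      ≤ 16 * CH * CH * mT j i * (Zl 4 (aa / 2) * Zl 4 (δ / 2))
        * Real.exp (-(min (kappa163 4 / 4 / 8) (((m + 1 : ℕ) : ℝ) * (δ / 2))) * l1 (y' - y)) :=
        mul_le_mul_of_nonneg_left hexp (by positivity)
    _ = (16 * K₀ ^ 2 * ((((m + 1 : ℕ) : ℝ) ^ 4)⁻¹ * Zl 4 (aa / 2)))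
        * (Zl 4 (δ / 2) * ((((m + 1 : ℕ) : ℝ)) ^ 4)⁻¹ * mT j i)
        * Real.exp (-(min (kappa163 4 / 4 / 8) (((m + 1 : ℕ) : ℝ) * (δ / 2))) * l1 (y' - y)) := by
        rw [eCH]; ring
    _ ≤ (16 * K₀ ^ 2 * B) * (Zl 4 (δ / 2) * ((((m + 1 : ℕ) : ℝ)) ^ 4)⁻¹ * mT j i)
        * Real.exp (-(min (kappa163 4 / 4 / 8) (((m + 1 : ℕ) : ℝ) * (δ / 2))) * l1 (y' - y)) := by
        have h1 : 16 * K₀ ^ 2 * ((((m + 1 : ℕ) : ℝ) ^ 4)⁻¹ * Zl 4 (aa / 2)) ≤ 16 * K₀ ^ 2 * B :=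
          mul_le_mul_of_nonneg_left hZl (by positivity)
        exact mul_le_mul_of_nonneg_right (mul_le_mul_of_nonneg_right h1 hrest) (Real.exp_pos _).le
    _ = 16 * K₀ ^ 2 * B * Zl 4 (δ / 2) * ((((m + 1 : ℕ) : ℝ)) ^ 4)⁻¹ * mT j i
        * Real.exp (-(min (kappa163 4 / 4 / 8) (((m + 1 : ℕ) : ℝ) * (δ / 2))) * l1 (y' - y)) := by
        ring

/-- [folklore] **COROLLARY AT A BLOCK-SCALE PAIR RATE**: if the pair letters decay at `δ = δ₀∕n` (`0 < δ₀`), the table rate is the n-FREE `min (κ′∕8) (δ₀∕2)`: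
`… ≤ 16·C_{G₀}²·(1 + 16∕κ′)⁴·Zl 4 (δ₀∕(2n))·(n⁴)⁻¹·mT j i·e^{−min (κ′∕8) (δ₀∕2)·|y′ − y|₁}` (the displayed floor shape `δ₀∕n` of 12b's other slots). -/
theorem mass_blk_vertex2OfK_G₀_le_blockRate {S₂ : Fin 4 → Site 4 → Fin 4 → Site 4 → MKer 4 (Fib 3)} {δ₀ : ℝ} {mT : Bool → Bool → ℝ} (hδ₀ : 0 < δ₀)
    (hTs : ∀ κ u κ' u' j i, Summable fun p : Site 4 × Site 4 => ∑ g, ∑ f, |blk (S₂ κ u κ' u') j i p.1 p.2 g f|)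
    (hTm : ∀ κ u κ' u' j i, ∑' p : Site 4 × Site 4, ∑ g, ∑ f, |blk (S₂ κ u κ' u') j i p.1 p.2 g f|
      ≤ mT j i * Real.exp (-(δ₀ / ((m + 1 : ℕ) : ℝ)) * l1 (u' - u)))
    (μ : Fin 4) (y : Site 4) (ν : Fin 4) (y' : Site 4) (j i : Bool) :
    (Summable fun p : Site 4 × Site 4 => ∑ g, ∑ f,
        |blk (vertex2OfK (coDressKBmAt (toSite r) (m + 1) (KInvStep (d := 3) (m + 1) 0)) (m + 1) S₂ μ y ν y') j i p.1 p.2 g f|) ∧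
      ∑' p : Site 4 × Site 4, ∑ g, ∑ f,
          |blk (vertex2OfK (coDressKBmAt (toSite r) (m + 1) (KInvStep (d := 3) (m + 1) 0)) (m + 1) S₂ μ y ν y') j i p.1 p.2 g f|
        ≤ 16 * ((MG163 4 * periodConst (kappa163 4) 3) * (1 + 8 * (1 + Real.exp (kappa163 4 / 4))) * Real.exp (kappa163 4 / 4)) ^ 2
            * (1 + 16 / (kappa163 4 / 4)) ^ 4 * Zl 4 (δ₀ / ((m + 1 : ℕ) : ℝ) / 2)
          * ((((m + 1 : ℕ) : ℝ)) ^ 4)⁻¹ * mT j i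
          * Real.exp (-(min (kappa163 4 / 4 / 8) (δ₀ / 2)) * l1 (y' - y)) := by
  have hn0 : (0 : ℝ) < ((m + 1 : ℕ) : ℝ) := by exact_mod_cast Nat.succ_pos m
  have hδ : 0 < δ₀ / ((m + 1 : ℕ) : ℝ) := div_pos hδ₀ hn0
  have h := mass_blk_vertex2OfK_G₀_le' m hr hδ hTs hTm μ y ν y' j i
  have e : ((m + 1 : ℕ) : ℝ) * (δ₀ / ((m + 1 : ℕ) : ℝ) / 2) = δ₀ / 2 := by
    field_simp
  rw [e] at h
  exact h

end Summit.QuantumFields.BalabanUV.Beta.D1BFx.PackedColumnTableMass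

end
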